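import Literature.MathematicalPhysics.QuantumFieldTheory.ONVectorCertificate
import Literature.MathematicalPhysics.QuantumFieldTheory.ConformalBootstrap3D.TwoSignHeadCellsHalf
import HarnessLib

/-!
# The `O(N)` vector points certificate as a finite table

Topic `MathematicalPhysics/QuantumFieldTheory`; theorems only (no named fact, no instance,
no `sorry`).

`ONVectorCertificate` fixes the FORMAT of a linear-functional certificate for the `O(N)` vector
bootstrap of Kos–Poland–Simmons-Duffin 2014 (§2.1–2.2): a three-component point functional
`α = Σ_k Σ_r w_{k,r} ev_{(u_k,v_k), r}` with nodes on the diamond discharging the obligation list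
`VectorObligations α N A Q E` ((O1) unit, (O2)–(O6) trial range, (O7)–(O9) tails) proves
`VectorExcluded N A Q`; and its dictionary (`rowNonnegS/T/A_of_crossF`, `diamondFunctional_unit_eq`)
turns every row into a TWO-SIGN single-correlator row
`g ↦ φ[a⁻](F^{s}_{-}[g]) + φ[a⁺](F^{s}_{+}[g])` at the weights `(wSm w, wSp w)` (singlets),
`(wTm N w, wTp N w)` (traceless symmetric), `(wAm w, wAp w)` (antisymmetric).
`ConformalBootstrap3D.TwoSignRows` / `TwoSignHeadCells` / `TwoSignHeadCellsHalf` decide such rows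
from finitely many closed-form numbers (Hogervorst–Rychkov `z`-series: head cells with two-sided
coefficient bounds — monotone, interval, or residue-scaled `half` tables down to `Δ = 1/2`,
rule (M) from box tables with a term-rule bit (corner `cornerBound₂` | chord `termChordMin₂`) on the
twist-gap domain, rule (T) from ONE `apexRest₂` inequality, the limit clause at non-regular points,
the unit row from one corner number).

This file is the composition:

* `VectorObligations.of_twoSign` — the nine obligations of the diamond functional from two-sign
  families (unit, two scalar ranges, three spin ranges, three tails stated as `TwoSignPositive`);
* `exists_light_scalar_of_vectorExcluded` — the bound a certificate proves about an actual datum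
  (a singlet scalar below `Δ_S` or a symmetric-tensor scalar below `Δ_T`);
* `vectorExcluded_of_twoSignTables` — **the certificate schema**: nodes in the open square with
  `z̄_k ≤ z_k` and a dominating apex, an external interval `[s_lo, s_hi]`, and PER SECTOR the apex
  weight sign, an (M) box table, one apex inequality, a row of scalar head cells starting at the
  sector's gap (`S`, `T`) and one row of head cells per spin below `L` (`E₀ ≤ L + 1`; even non-zero
  spins for `S`, `T`, odd spins for `A`), each cell with its head level `n_F`, a term-rule bit
  (corner | chord; chord cells and boxes carry the node-ratio side condition for their width) and,
  on the scalar rows, TWO coefficient-rule bits (monotone | interval | half: gaps between the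
  unitarity bound `1/2` and `1` are certifiable, and with `half` a scalar row may start AT `1/2`,
  i.e. carry no gap assumption at all — the symmetric-tensor scalars of the singlet bound of
  Kos–Poland–Simmons-Duffin), and ONE number `headCellNumber₃ ≥ 0` (`headCellNumber₂ … false ≥ 0`
  on the spinning rows); plus the
  unit row as a chord row on a partition of the `s`-width and the global `s`-width node-ratio
  condition.  Conclusion:
  `VectorExcluded N A [s_lo, s_hi]` (`2 ≤ N`) — the two-sign analogue, sector by sector, of the
  one-functional table `boxExcluded_of_pointTable₂`.

Every hypothesis except the node geometry is a sign condition on a closed-form real number of the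
certificate data (rational data ⇒ decidable by evaluation), which is what a client cell's checker
verifies; no number of any client cell is asserted here.

References: F. Kos, D. Poland, D. Simmons-Duffin, "Bootstrapping the O(N) vector models", JHEP 06
(2014) 091, arXiv:1307.6856, §2.1–2.2 [key KosPolandSimmonsduffin2014ON]; R. Rattazzi, V. Rychkov,
E. Tonni, A. Vichi, JHEP 12 (2008) 031, arXiv:0807.0004, §5.5 [key RattazziEtAl2008];
M. Hogervorst, S. Rychkov, Phys. Rev. D 87 (2013) 106004, arXiv:1303.1111, §3 eq. (3.9)
[key HogervorstRychkov2013].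
-/

namespace Literature.MathematicalPhysics.QuantumFieldTheory.ONVectorCertificate

open Set Finset
open ONVectorSumRule (VS)
open ConformalBootstrap3D

noncomputable section

variable {M : ℕ} (w : Fin M → Fin 3 → ℝ) {z zb : Fin M → ℝ}

/-- **The obligations of the diamond functional from two-sign row families.** (O1) from the unit
two-sign row at `(wSm, wSp)`; (O2)/(O4)/(O7) from `TwoSignPositive (wSm w) (wSp w)`, (O3)/(O5)/(O8)
from `TwoSignPositive (wTm N w) (wTp N w)`, (O6)/(O9) from `TwoSignPositive (wAm w) (wAp w)` on the
corresponding ranges (tails for every spin; the parity restriction is dropped).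
[cite: KosPolandSimmonsduffin2014ON, §2.2] -/
theorem VectorObligations.of_twoSign {N : ℕ} {A : VectorGaps} {Q : Set ℝ} {E : ℝ}
    (hz : ∀ k, z k ∈ Ioo (0 : ℝ) 1) (hzb : ∀ k, zb k ∈ Ioo (0 : ℝ) 1)
    (hU : ∀ s ∈ Q, 0 < pointFunctional (wSm w) z zb (crossF s (-1) (fun _ _ => (1 : ℝ))) +
      pointFunctional (wSp w) z zb (crossF s 1 (fun _ _ => (1 : ℝ))))
    (hS0 : ∀ s ∈ Q, ∀ Δ : ℝ, A.ΔS ≤ Δ → Δ < E → TwoSignPositive (wSm w) (wSp w) z zb s Δ 0)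
    (hT0 : ∀ s ∈ Q, ∀ Δ : ℝ, A.ΔT ≤ Δ → Δ < E → TwoSignPositive (wTm N w) (wTp N w) z zb s Δ 0)
    (hS : ∀ s ∈ Q, ∀ ℓ : ℕ, Even ℓ → ℓ ≠ 0 → ∀ Δ : ℝ, (ℓ : ℝ) + 1 ≤ Δ → Δ < E →
      TwoSignPositive (wSm w) (wSp w) z zb s Δ ℓ)
    (hT : ∀ s ∈ Q, ∀ ℓ : ℕ, Even ℓ → ℓ ≠ 0 → ∀ Δ : ℝ, (ℓ : ℝ) + 1 ≤ Δ → Δ < E →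
      TwoSignPositive (wTm N w) (wTp N w) z zb s Δ ℓ)
    (hA : ∀ s ∈ Q, ∀ ℓ : ℕ, Odd ℓ → ∀ Δ : ℝ, (ℓ : ℝ) + 1 ≤ Δ → Δ < E →
      TwoSignPositive (wAm w) (wAp w) z zb s Δ ℓ)
    (htS : ∀ s ∈ Q, ∀ (ℓ : ℕ) (Δ : ℝ), unitarityBound3D ℓ ≤ Δ → E ≤ Δ →
      TwoSignPositive (wSm w) (wSp w) z zb s Δ ℓ)
    (htT : ∀ s ∈ Q, ∀ (ℓ : ℕ) (Δ : ℝ), unitarityBound3D ℓ ≤ Δ → E ≤ Δ →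
      TwoSignPositive (wTm N w) (wTp N w) z zb s Δ ℓ)
    (htA : ∀ s ∈ Q, ∀ (ℓ : ℕ) (Δ : ℝ), unitarityBound3D ℓ ≤ Δ → E ≤ Δ →
      TwoSignPositive (wAm w) (wAp w) z zb s Δ ℓ) :
    VectorObligations (diamondFunctional w z zb) N A Q E where
  unit_pos := fun s hs => by rw [diamondFunctional_unit_eq w hz hzb]; exact hU s hs
  scalarS := fun s hs Δ h1 h2 => rowNonnegS_of_crossF w hz hzb (hS0 s hs Δ h1 h2)
  scalarT := fun s hs Δ h1 h2 => rowNonnegT_of_crossF w hz hzb (hT0 s hs Δ h1 h2)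
  spinS := fun s hs ℓ he h0 Δ h1 h2 => rowNonnegS_of_crossF w hz hzb (hS s hs ℓ he h0 Δ h1 h2)
  spinT := fun s hs ℓ he h0 Δ h1 h2 => rowNonnegT_of_crossF w hz hzb (hT s hs ℓ he h0 Δ h1 h2)
  spinA := fun s hs ℓ ho Δ h1 h2 => rowNonnegA_of_crossF w hz hzb (hA s hs ℓ ho Δ h1 h2)
  tailS := fun s hs ℓ _ Δ hb hE => rowNonnegS_of_crossF w hz hzb (htS s hs ℓ Δ hb hE)
  tailT := fun s hs ℓ _ Δ hb hE => rowNonnegT_of_crossF w hz hzb (htT s hs ℓ Δ hb hE)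
  tailA := fun s hs ℓ _ Δ hb hE => rowNonnegA_of_crossF w hz hzb (htA s hs ℓ Δ hb hE)

/-- **What a certificate says about an actual datum** (the bound shape of the cited §4.1/§4.2
plots): if `VectorExcluded N A Q` and `Δ_φ ∈ Q`, the datum has a singlet scalar below `Δ_S` or a
symmetric-tensor scalar below `Δ_T`. [cite: KosPolandSimmonsduffin2014ON, §4.1] -/
theorem exists_light_scalar_of_vectorExcluded {N : ℕ} {A : VectorGaps} {Q : Set ℝ}
    (h : VectorExcluded N A Q) (D : VectorDatum N) (hD : D.Δφ ∈ Q) :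
    (∃ o, D.spinS o = 0 ∧ D.dimS o < A.ΔS) ∨ ∃ o, D.spinT o = 0 ∧ D.dimT o < A.ΔT := by
  by_contra hc
  push Not at hc
  exact h D hD ⟨fun o ho => hc.1 o ho, fun o ho => hc.2 o ho⟩

/-- **The `O(N)` vector points certificate schema.** Nodes `(z_k, z̄_k)` in the open square with
`z̄_k ≤ z_k`, an apex node dominating every direct and reflected node (`qd_k, qr_k ∈ (0,1]`),
external dimensions `s ∈ [s_lo, s_hi]`, a tail threshold `E₀` with twist-gap parameter `τ ≤ 1`,
`τ ≤ E₀`, an apex level `E_T`, a spin bound `L` with `E₀ ≤ L + 1`; node ratios `≥ 1/2` for the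
`s`-width; the unit row as a chord ROW (a monotone partition `σ` of `[s_lo, s_hi]` with one
`termChordMin₂ … 0 σ_i σ_{i+1} 0 0 > 0` per piece); and for each sector `X ∈ {S, T, A}` with
two-sign weights `(a⁻_X, a⁺_X) = (wSm w, wSp w)`, `(wTm N w, wTp N w)`, `(wAm w, wAp w)`: the
apex weight `a⁻_X + a⁺_X ≥ 0` at the apex, an (M) box table with a term-rule bit per box
(corner | chord, chord boxes with node ratios `≥ 1/2` for their width) and numbers `boxNumber₂ ≥ 0`,
ONE apex inequality,
(for `S`, `T`) a row of scalar head cells from the sector gap to `E₀` — each with a head level `n_F`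
(`t_k + n_F + 1 ≥ E₀`), a term-rule bit, two coefficient-rule bits (monotone: start `≥ 1`;
interval: start `> 1/2` and `≥ τ`; half: start `≥ 1/2` and `≥ τ` — the half bit wins) and ONE
`headCellNumber₃ ≥ 0` — and (for all three) a row of head cells `[ℓ+1, E₀)` per spin `ℓ < L` of
the sector's parity, each with a head level, a term-rule bit and ONE `headCellNumber₂ … false ≥ 0`.
Then no `O(N)` vector datum with `Δ_φ ∈ [s_lo, s_hi]` obeys the gaps `A` (`2 ≤ N`).
[cite: KosPolandSimmonsduffin2014ON, §2.2] -/
theorem vectorExcluded_of_twoSignTables {N : ℕ} (hN : 2 ≤ N) {A : VectorGaps}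
    (hz : ∀ k, z k ∈ Ioo (0 : ℝ) 1) (hzb : ∀ k, zb k ∈ Ioo (0 : ℝ) 1) (hord : ∀ k, zb k ≤ z k)
    (apex : Fin M) (qd qr : Fin M → ℝ) (hqd : ∀ k, 0 < qd k ∧ qd k ≤ 1)
    (hqr : ∀ k, 0 < qr k ∧ qr k ≤ 1)
    (hdomd : ∀ k, z k * zb k ≤ qd k ^ 2 * (z apex * zb apex) ∧ z k ≤ qd k * z apex)
    (hdomr : ∀ k, (1 - z k) * (1 - zb k) ≤ qr k ^ 2 * (z apex * zb apex) ∧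
      1 - zb k ≤ qr k * z apex)
    {slo shi E₀ ET τ : ℝ} (hτ1 : τ ≤ 1) (hτ0 : τ ≤ E₀) (L : ℕ) (hL : E₀ ≤ (L : ℝ) + 1)
    (hr : ∀ k, 1 / 2 ≤ ((1 - z k) * (1 - zb k)) ^ (shi - slo) ∧ 1 / 2 ≤ (z k * zb k) ^ (shi - slo))
    -- (O1): the unit row as a chord row on a monotone partition `σ` of `[s_lo, s_hi]`
    (σ : ℕ → ℝ) (KI : ℕ) (hKI : 0 < KI) (hσ0 : σ 0 = slo) (hσK : σ KI = shi)
    (hσmono : ∀ i < KI, σ i ≤ σ (i + 1))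
    (hIrow : ∀ i < KI,
      0 < termChordMin₂ (wSm w + wSp w) (wSm w - wSp w) z zb 0 (σ i) (σ (i + 1)) 0 0)
    -- sector S: apex weight, (M) table with term bits, (T) inequality, scalar cells from `Δ_S`
    -- (head level, term bit, coefficient bit), even-spin cells (head level, term bit)
    (haS : 0 ≤ wSm w apex + wSp w apex) (eS : ℕ → ℕ → ℝ) (MS : ℕ → ℕ) (bS : ℕ → ℕ → Bool)
    (heS : ∀ j : ℕ, (j : ℝ) + τ < ET → eS j 0 ≤ max E₀ ((j : ℝ) + τ) ∧ ET ≤ eS j (MS j))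
    (hρbS : ∀ j m, m < MS j → bS j m = true → ∀ i,
      1 / 2 ≤ (z i * zb i) ^ ((eS j (m + 1) - eS j m) / 2) ∧
        1 / 2 ≤ ((1 - z i) * (1 - zb i)) ^ ((eS j (m + 1) - eS j m) / 2))
    (hboxS : ∀ j : ℕ, (j : ℝ) + τ < ET → ∀ m < MS j,
      0 ≤ boxNumber₂ (wSm w) (wSp w) z zb j (eS j m) (eS j (m + 1)) slo shi (bS j m))
    (hBS : apexRest₂ (wSm w + wSp w) (wSm w - wSp w) z zb apex qd qr slo ET ≤
      (wSm w apex + wSp w apex) * ((1 - z apex) * (1 - zb apex)) ^ shi)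
    (tS : ℕ → ℝ) (KS : ℕ) (htS0 : tS 0 ≤ A.ΔS) (htSK : tS KS = E₀) (nS : ℕ → ℕ)
    (cS iS hS : ℕ → Bool)
    (htS1 : ∀ k < KS, hS k = false → iS k = false → (1 : ℝ) ≤ tS k)
    (htS2 : ∀ k < KS, hS k = false → iS k = true → (1 / 2 : ℝ) < tS k ∧ τ ≤ tS k)
    (htS3 : ∀ k < KS, hS k = true → (1 / 2 : ℝ) ≤ tS k ∧ τ ≤ tS k)
    (hρtS : ∀ k < KS, cS k = true → ∀ i,
      1 / 2 ≤ (z i * zb i) ^ ((tS (k + 1) - tS k) / 2) ∧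
        1 / 2 ≤ ((1 - z i) * (1 - zb i)) ^ ((tS (k + 1) - tS k) / 2))
    (hnS : ∀ k < KS, E₀ ≤ tS k + ((nS k : ℝ) + 1))
    (hheadS : ∀ k < KS, 0 ≤ headCellNumber₃ (wSm w) (wSp w) z zb (tS k) (tS (k + 1)) slo shi
      (nS k) (cS k) (iS k) (hS k))
    (uS : ℕ → ℕ → ℝ) (KuS : ℕ → ℕ)
    (huS0 : ∀ ℓ, Even ℓ → ℓ ≠ 0 → ℓ < L → uS ℓ 0 ≤ (ℓ : ℝ) + 1)
    (huSK : ∀ ℓ, Even ℓ → ℓ ≠ 0 → ℓ < L → uS ℓ (KuS ℓ) = E₀)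
    (huSa : ∀ ℓ, Even ℓ → ℓ ≠ 0 → ℓ < L → ∀ k < KuS ℓ, (ℓ : ℝ) + 1 ≤ uS ℓ k)
    (mS : ℕ → ℕ → ℕ) (dS : ℕ → ℕ → Bool)
    (hρuS : ∀ ℓ, Even ℓ → ℓ ≠ 0 → ℓ < L → ∀ k < KuS ℓ, dS ℓ k = true → ∀ i,
      1 / 2 ≤ (z i * zb i) ^ ((uS ℓ (k + 1) - uS ℓ k) / 2) ∧
        1 / 2 ≤ ((1 - z i) * (1 - zb i)) ^ ((uS ℓ (k + 1) - uS ℓ k) / 2))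
    (hmS : ∀ ℓ, Even ℓ → ℓ ≠ 0 → ℓ < L → ∀ k < KuS ℓ, E₀ ≤ uS ℓ k + ((mS ℓ k : ℝ) + 1))
    (hheaduS : ∀ ℓ, Even ℓ → ℓ ≠ 0 → ℓ < L → ∀ k < KuS ℓ,
      0 ≤ headCellNumber₂ (wSm w) (wSp w) z zb ℓ (uS ℓ k) (uS ℓ (k + 1)) slo shi (mS ℓ k)
        (dS ℓ k) false)
    -- sector T: the same at the weights `(wTm N w, wTp N w)`, scalar cells from `Δ_T`
    (haT : 0 ≤ wTm N w apex + wTp N w apex) (eT : ℕ → ℕ → ℝ) (MT : ℕ → ℕ) (bT : ℕ → ℕ → Bool)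
    (heT : ∀ j : ℕ, (j : ℝ) + τ < ET → eT j 0 ≤ max E₀ ((j : ℝ) + τ) ∧ ET ≤ eT j (MT j))
    (hρbT : ∀ j m, m < MT j → bT j m = true → ∀ i,
      1 / 2 ≤ (z i * zb i) ^ ((eT j (m + 1) - eT j m) / 2) ∧
        1 / 2 ≤ ((1 - z i) * (1 - zb i)) ^ ((eT j (m + 1) - eT j m) / 2))
    (hboxT : ∀ j : ℕ, (j : ℝ) + τ < ET → ∀ m < MT j,
      0 ≤ boxNumber₂ (wTm N w) (wTp N w) z zb j (eT j m) (eT j (m + 1)) slo shi (bT j m))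
    (hBT : apexRest₂ (wTm N w + wTp N w) (wTm N w - wTp N w) z zb apex qd qr slo ET ≤
      (wTm N w apex + wTp N w apex) * ((1 - z apex) * (1 - zb apex)) ^ shi)
    (tT : ℕ → ℝ) (KT : ℕ) (htT0 : tT 0 ≤ A.ΔT) (htTK : tT KT = E₀) (nT : ℕ → ℕ)
    (cT iT hT : ℕ → Bool)
    (htT1 : ∀ k < KT, hT k = false → iT k = false → (1 : ℝ) ≤ tT k)
    (htT2 : ∀ k < KT, hT k = false → iT k = true → (1 / 2 : ℝ) < tT k ∧ τ ≤ tT k)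
    (htT3 : ∀ k < KT, hT k = true → (1 / 2 : ℝ) ≤ tT k ∧ τ ≤ tT k)
    (hρtT : ∀ k < KT, cT k = true → ∀ i,
      1 / 2 ≤ (z i * zb i) ^ ((tT (k + 1) - tT k) / 2) ∧
        1 / 2 ≤ ((1 - z i) * (1 - zb i)) ^ ((tT (k + 1) - tT k) / 2))
    (hnT : ∀ k < KT, E₀ ≤ tT k + ((nT k : ℝ) + 1))
    (hheadT : ∀ k < KT, 0 ≤ headCellNumber₃ (wTm N w) (wTp N w) z zb (tT k) (tT (k + 1)) slo shi
      (nT k) (cT k) (iT k) (hT k))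
    (uT : ℕ → ℕ → ℝ) (KuT : ℕ → ℕ)
    (huT0 : ∀ ℓ, Even ℓ → ℓ ≠ 0 → ℓ < L → uT ℓ 0 ≤ (ℓ : ℝ) + 1)
    (huTK : ∀ ℓ, Even ℓ → ℓ ≠ 0 → ℓ < L → uT ℓ (KuT ℓ) = E₀)
    (huTa : ∀ ℓ, Even ℓ → ℓ ≠ 0 → ℓ < L → ∀ k < KuT ℓ, (ℓ : ℝ) + 1 ≤ uT ℓ k)
    (mT : ℕ → ℕ → ℕ) (dT : ℕ → ℕ → Bool)
    (hρuT : ∀ ℓ, Even ℓ → ℓ ≠ 0 → ℓ < L → ∀ k < KuT ℓ, dT ℓ k = true → ∀ i,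
      1 / 2 ≤ (z i * zb i) ^ ((uT ℓ (k + 1) - uT ℓ k) / 2) ∧
        1 / 2 ≤ ((1 - z i) * (1 - zb i)) ^ ((uT ℓ (k + 1) - uT ℓ k) / 2))
    (hmT : ∀ ℓ, Even ℓ → ℓ ≠ 0 → ℓ < L → ∀ k < KuT ℓ, E₀ ≤ uT ℓ k + ((mT ℓ k : ℝ) + 1))
    (hheaduT : ∀ ℓ, Even ℓ → ℓ ≠ 0 → ℓ < L → ∀ k < KuT ℓ,
      0 ≤ headCellNumber₂ (wTm N w) (wTp N w) z zb ℓ (uT ℓ k) (uT ℓ (k + 1)) slo shi (mT ℓ k)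
        (dT ℓ k) false)
    -- sector A: the same at the weights `(wAm w, wAp w)`, odd spins, no scalar cells
    (haA : 0 ≤ wAm w apex + wAp w apex) (eA : ℕ → ℕ → ℝ) (MA : ℕ → ℕ) (bA : ℕ → ℕ → Bool)
    (heA : ∀ j : ℕ, (j : ℝ) + τ < ET → eA j 0 ≤ max E₀ ((j : ℝ) + τ) ∧ ET ≤ eA j (MA j))
    (hρbA : ∀ j m, m < MA j → bA j m = true → ∀ i,
      1 / 2 ≤ (z i * zb i) ^ ((eA j (m + 1) - eA j m) / 2) ∧
        1 / 2 ≤ ((1 - z i) * (1 - zb i)) ^ ((eA j (m + 1) - eA j m) / 2))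
    (hboxA : ∀ j : ℕ, (j : ℝ) + τ < ET → ∀ m < MA j,
      0 ≤ boxNumber₂ (wAm w) (wAp w) z zb j (eA j m) (eA j (m + 1)) slo shi (bA j m))
    (hBA : apexRest₂ (wAm w + wAp w) (wAm w - wAp w) z zb apex qd qr slo ET ≤
      (wAm w apex + wAp w apex) * ((1 - z apex) * (1 - zb apex)) ^ shi)
    (uA : ℕ → ℕ → ℝ) (KuA : ℕ → ℕ)
    (huA0 : ∀ ℓ, Odd ℓ → ℓ < L → uA ℓ 0 ≤ (ℓ : ℝ) + 1)
    (huAK : ∀ ℓ, Odd ℓ → ℓ < L → uA ℓ (KuA ℓ) = E₀)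
    (huAa : ∀ ℓ, Odd ℓ → ℓ < L → ∀ k < KuA ℓ, (ℓ : ℝ) + 1 ≤ uA ℓ k)
    (mA : ℕ → ℕ → ℕ) (dA : ℕ → ℕ → Bool)
    (hρuA : ∀ ℓ, Odd ℓ → ℓ < L → ∀ k < KuA ℓ, dA ℓ k = true → ∀ i,
      1 / 2 ≤ (z i * zb i) ^ ((uA ℓ (k + 1) - uA ℓ k) / 2) ∧
        1 / 2 ≤ ((1 - z i) * (1 - zb i)) ^ ((uA ℓ (k + 1) - uA ℓ k) / 2))
    (hmA : ∀ ℓ, Odd ℓ → ℓ < L → ∀ k < KuA ℓ, E₀ ≤ uA ℓ k + ((mA ℓ k : ℝ) + 1))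
    (hheaduA : ∀ ℓ, Odd ℓ → ℓ < L → ∀ k < KuA ℓ,
      0 ≤ headCellNumber₂ (wAm w) (wAp w) z zb ℓ (uA ℓ k) (uA ℓ (k + 1)) slo shi (mA ℓ k)
        (dA ℓ k) false)
    : VectorExcluded N A (Icc slo shi) := by
  have hPS := spinRange_twoSign_of_pointTables (wSm w) (wSp w) z zb hz hzb hord apex haS qd qr hqd
    hqr hdomd hdomr hτ1 hr eS MS bS heS hρbS hboxS hBS (fun ℓ => Even ℓ ∧ ℓ ≠ 0) L hL uS KuS
    (fun ℓ h => huS0 ℓ h.1 h.2) (fun ℓ h => huSK ℓ h.1 h.2) (fun ℓ h => huSa ℓ h.1 h.2) mS dS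
    (fun ℓ h => hρuS ℓ h.1 h.2) (fun ℓ h => hmS ℓ h.1 h.2) (fun ℓ h => hheaduS ℓ h.1 h.2)
  have hPT := spinRange_twoSign_of_pointTables (wTm N w) (wTp N w) z zb hz hzb hord apex haT qd qr
    hqd hqr hdomd hdomr hτ1 hr eT MT bT heT hρbT hboxT hBT (fun ℓ => Even ℓ ∧ ℓ ≠ 0) L hL uT KuT
    (fun ℓ h => huT0 ℓ h.1 h.2) (fun ℓ h => huTK ℓ h.1 h.2) (fun ℓ h => huTa ℓ h.1 h.2) mT dT
    (fun ℓ h => hρuT ℓ h.1 h.2) (fun ℓ h => hmT ℓ h.1 h.2) (fun ℓ h => hheaduT ℓ h.1 h.2)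
  refine vectorExcluded_of_diamondFunctional w hN hz hzb (E := E₀)
    (VectorObligations.of_twoSign w hz hzb ?_ ?_ ?_ ?_ ?_ ?_ ?_ ?_ ?_)
  · exact twoSign_identity_pos_of_chordRow₂ (wSm w) (wSp w) z zb hz hzb hr σ KI hKI hσ0 hσK hσmono
      hIrow
  · exact scalarRange_twoSign_of_pointTables₃ (wSm w) (wSp w) z zb hz hzb hord apex haS qd qr hqd
      hqr hdomd hdomr hτ1 hr eS MS bS heS hρbS hboxS hBS tS KS htS0 htSK nS cS iS hS htS1 htS2 htS3
      hρtS hnS hheadS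
  · exact scalarRange_twoSign_of_pointTables₃ (wTm N w) (wTp N w) z zb hz hzb hord apex haT qd qr
      hqd hqr hdomd hdomr hτ1 hr eT MT bT heT hρbT hboxT hBT tT KT htT0 htTK nT cT iT hT htT1 htT2
      htT3 hρtT hnT hheadT
  · exact fun s hs ℓ he h0 => hPS s hs ℓ ⟨he, h0⟩
  · exact fun s hs ℓ he h0 => hPT s hs ℓ ⟨he, h0⟩
  · exact spinRange_twoSign_of_pointTables (wAm w) (wAp w) z zb hz hzb hord apex haA qd qr hqd hqr
      hdomd hdomr hτ1 hr eA MA bA heA hρbA hboxA hBA Odd L hL uA KuA huA0 huAK huAa mA dA hρuA hmA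
      hheaduA
  · exact tail_twoSignPositive_of_table₂_and_apex (wSm w) (wSp w) z zb hz hzb hord apex haS qd qr
      hqd hqr hdomd hdomr hτ1 hτ0 hr eS MS bS heS hρbS hboxS hBS
  · exact tail_twoSignPositive_of_table₂_and_apex (wTm N w) (wTp N w) z zb hz hzb hord apex haT qd
      qr hqd hqr hdomd hdomr hτ1 hτ0 hr eT MT bT heT hρbT hboxT hBT
  · exact tail_twoSignPositive_of_table₂_and_apex (wAm w) (wAp w) z zb hz hzb hord apex haA qd qr
      hqd hqr hdomd hdomr hτ1 hτ0 hr eA MA bA heA hρbA hboxA hBA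

end

end Literature.MathematicalPhysics.QuantumFieldTheory.ONVectorCertificate
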